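import Summits.QuantumFields.Balaban3D.Proofs.TransportAC
import Summits.QuantumFields.Balaban3D.Proofs.Bound55Masses
import Summits.QuantumFields.Balaban3D.Proofs.TowerAC
import HarnessLib

/-!
# R3 (cell `ym3-torus`, YM₃ on T³ — a ladder RUNG, NOT d = 4, NOT the Clay problem), UV3-node side of the 19936 deep-heights target
# `stub_pinnedStep` (R-19936-S) — **THE PINNED TRANSPORT STEP**: Bałaban's (48)–(49) `dV`-a.e. with the decomposition of unity (7)
# inserted for a DOMINATED refinement mass, the pinned cover («a plaquette that is large at the event threshold lies in THE large-field
# set of the configuration»), and the restricted history sum against the penalised functional of (41)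

Seat `ym3-torus-px8` g11 (width copy of ym3-torus-p1 = R3's UV-stability node).  THEOREMS ONLY (0 `def`, 0 `sorry`);
`--supports stmt-QuantumFields-19936 --as helper`; count-neutral.  LOCATE `pub/ym3-torus/ym3-torus-px8/g11/LOCATE-PINNED41-RESTRICTION-px8g11.md`
(19936 evidence #57) §1(b)/§4 BRICK A: the pinned (41) for the AC tower above the pinned level is the lane's Theorem-2 induction
(`Balaban3D.Proofs.Thm2AC`) re-threaded with the history sum RESTRICTED; at the pinned level the event indicator `𝟙_A` is spent
POINTWISE in choosing which new histories cover (`Bound55Masses.stepWeight_mul_chiB_cover` picks `h ⌢ largeSet(h,U)`, and `a ∈ largeSet(h,U)`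
when `a` is large at a threshold `≥ εL k` inside the decomposition domain — §2 below), after which the lane's (β) fibre row `Fibre49AC` and
mass recursion `hm₁` apply VERBATIM to the UN-pinned masses.  The one generic lemma this needs and the tree lacks is §1: the transport step
`TransportAC.transport41_le_sum_ae_of_ac` with the density majorised through a mass `m₀` (for the cover) that is DOMINATED by the mass `m₀'`
the fibre row and the recursion speak about (`m₀ = 𝟙_A·m_k ≤ m_k = m₀'`).

WHAT IS PROVED (ns `…Theorems.UV3PinnedTransportStep`):
* §1 ★★ `transport41_le_sum_ae_of_ac_of_le` — (48)–(49) `dV`-a.e. under `AvgAC` for a DOMINATED refinement: `ρ ≤ Σ_h m₀(h)e^{F₀(h)}` pointwise,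
  `0 ≤ m₀ ≤ m₀'`, cover asked only where `m₀ ≠ 0`, `hfibre`/`hm₁` asked for `m₀'` ⟹ `Tρ ≤ Σ_{h′} m₁(h′)·B(h′)` a.e.;
  ★ `transport41_le_sum_ae_of_ac_of_ae_le` — the same from an A.E. majorisation `ρ ≤ᵐ Σ_h m₀(h)e^{F₀(h)}` (`TransportAC.rnTransport_mono_ae_of_ae_le`),
  the form the cell's Radon–Nikodym tower delivers (★★OWNER RULING №32: a.e. letters only).
* §2 ★ `mem_largeSet_of_le` / ★ `mem_last_snoc_largeSet_of_le` — THE PINNED COVER: `εL k ≤ θ ≤ dist1 U(∂a)` and `plaqCover a ⊆ Ω_k(h)` put `a` into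
  `largeSet(h,U)`, i.e. into the newborn large-field set of the lane's covering history `h ⌢ largeSet(h,U)`.
* §3 ★ `sum_filter_mul_exp_le_lfAC_sub` — a history sum RESTRICTED to a sub-family is below the lane's functional `LFAC` at ANY exponent penalised
  off the sub-family (`π = 0` on it, arbitrary off it): the interface of ✓`UV3PinnedLargeFieldResummation.largeField_pinned_of_resummation`.

HONEST SCOPE.  Measure-theoretic and finite-sum bookkeeping over the lane's GENERIC transport lemmas; no bound of [Balaban1985UV3] is proved; the
(β) fibre row stays a hypothesis (`hfibre`); S-step ∕ `hlf` ∕ `hP` ∕ `HistoryTailL` (19936) ∕ UV3's inputs NOT proved; nothing continuum ∕ OS ∕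
mass-gap ∕ Clay.
References: T. Bałaban, CMP **102** (1985) 255–275 [Balaban1985UV3] ((7)–(8) pp. 257–258, (41) p. 266, (48)–(49) pp. 267–268).
-/

set_option autoImplicit false

noncomputable section

namespace Summit.QuantumFields.YangMills.Theorems.UV3PinnedTransportStep

open MeasureTheory
open Literature.MathematicalPhysics.QuantumFieldTheory.Balaban1983to89
open Literature.MathematicalPhysics.QuantumFieldTheory.Balaban1983to89.AveragingRT (rnTransport rnTransport_nonneg)
open Summit.QuantumFields.Balaban3D.Carriers
open Summit.QuantumFields.Balaban3D.Proofs.Transport48 (rnTransport_mono_ae rnTransport_sum_ae integrable_weight_mul)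
open Summit.QuantumFields.Balaban3D.Proofs.TransportAC (rnTransport_mono_ae_of_ae_le)
open Summit.QuantumFields.Balaban3D.Proofs.Bound55Masses (largeSet)
open Summit.QuantumFields.Balaban3D.Proofs.TowerAC (HistWeightsAC LFAC)

/-! ## §1 (48)–(49) `dV`-a.e. for a dominated refinement mass -/

section Transport

variable {P : Params} {j : ℕ} {G : Type*} [GaugeGroup G] [MeasurableSpace G] [HaarData G]
  {avg : GaugeField P j G → GaugeField P (j + 1) G}
  {H₀ H₁ : Type*} [Fintype H₀] [Fintype H₁]

/-- ★★ **(48)–(49) `dV`-a.e. UNDER ABSOLUTE CONTINUITY, FOR A DOMINATED REFINEMENT MASS.**  Fine lattice `j`, `Ū` absolutely continuous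
(`AvgAC`); old histories `H₀`, new histories `H₁` with `proj`; `ρ` integrable, majorised POINTWISE by `Σ_h m₀(h)·e^{F₀(h)}` (`h41`) with
`0 ≤ m₀ ≤ m₀'` (`hm₀0`, `hle`) and the `m₀'`-summands integrable (`hint'`); step weights `w h′ ∈ [0,1]` and small-field factors `χB h′ ∈ [0,1]`,
measurable; SOME new history above `h` of full weight wherever the SMALL mass `m₀(h)` is non-zero (`hcover` — for the pin: `m₀ = 𝟙_A·m_k`, and on
`A` the lane's covering history carries the pinned plaquette, §2); the new masses dominate the transported weighted LARGE masses
`T[w(h′)·m₀'(proj h′)] ≤ m₁(h′)` a.e. (`hm₁`, the lane's `MassesAC.transport_le_massRecAC_ae`); `B ≥ 0`; and per new history the fibre inequality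
FOR `m₀'` (`hfibre`, the lane's (β) row `Bound55AC.Fibre49AC`, not proved here).  THEN `Tρ ≤ Σ_{h′} m₁(h′)·B(h′)` `dV`-a.e.  Proof: the pointwise
insertion `ρ ≤ Σ_{h′} wχB·m₀'(proj h′)e^{F₀}` (cover where `m₀ ≠ 0`, then `m₀ ≤ m₀'`), `T` monotone and additive a.e., `hfibre`, `hm₁`.
[cite: Balaban1985UV3, (48)-(49) pp.267-268] -/
theorem transport41_le_sum_ae_of_ac_of_le (hac : AvgAC avg)
    (proj : H₁ → H₀) (ρ : Density P j G) (hρ : Integrable ρ (fieldMeasure P j G))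
    (m₀ m₀' : H₀ → Density P j G) (F₀ : H₀ → GaugeField P j G → ℝ)
    (w χB : H₁ → Density P j G) (m₁ B : H₁ → Density P (j + 1) G)
    (h41 : ∀ U, ρ U ≤ ∑ h, m₀ h U * Real.exp (F₀ h U))
    (hm₀0 : ∀ h U, 0 ≤ m₀ h U) (hle : ∀ h U, m₀ h U ≤ m₀' h U)
    (hint' : ∀ h, Integrable (fun U => m₀' h U * Real.exp (F₀ h U)) (fieldMeasure P j G))
    (hw : ∀ h', Measurable (w h')) (hw0 : ∀ h' U, 0 ≤ w h' U) (hw1 : ∀ h' U, w h' U ≤ 1)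
    (hχ : ∀ h', Measurable (χB h')) (hχ0 : ∀ h' U, 0 ≤ χB h' U) (hχ1 : ∀ h' U, χB h' U ≤ 1)
    (hcover : ∀ h U, m₀ h U ≠ 0 → ∃ h', proj h' = h ∧ (1 : ℝ) ≤ w h' U * χB h' U)
    (hm₁ : ∀ h', (rnTransport avg fun U => w h' U * m₀' (proj h') U) ≤ᵐ[fieldMeasure P (j + 1) G] m₁ h')
    (hB : ∀ h' V, 0 ≤ B h' V)
    (hfibre : ∀ h', (rnTransport avg (fun U => w h' U * χB h' U * (m₀' (proj h') U * Real.exp (F₀ (proj h') U))))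
      ≤ᵐ[fieldMeasure P (j + 1) G] fun V => rnTransport avg (fun U => w h' U * m₀' (proj h') U) V * B h' V) :
    rnTransport avg ρ ≤ᵐ[fieldMeasure P (j + 1) G] fun V => ∑ h', m₁ h' V * B h' V := by
  classical
  -- the refined summands over the new histories, with the LARGE mass
  set g : H₁ → Density P j G := fun h' U => w h' U * χB h' U * (m₀' (proj h') U * Real.exp (F₀ (proj h') U)) with hg
  have hgi : ∀ h', Integrable (g h') (fieldMeasure P j G) := fun h' =>
    integrable_weight_mul (hw h') (hχ h') (hw0 h') (hw1 h') (hχ0 h') (hχ1 h') (hint' (proj h'))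
  have hm₀'0 : ∀ h U, 0 ≤ m₀' h U := fun h U => (hm₀0 h U).trans (hle h U)
  have hg0 : ∀ h' U, 0 ≤ g h' U := fun h' U =>
    mul_nonneg (mul_nonneg (hw0 h' U) (hχ0 h' U)) (mul_nonneg (hm₀'0 _ U) (Real.exp_pos _).le)
  -- Step A (pointwise): insert the decomposition of unity where the small mass lives, then dominate
  have hpt : ∀ U, ρ U ≤ ∑ h', g h' U := by
    intro U
    refine (h41 U).trans ?_
    rw [← Finset.sum_fiberwise Finset.univ proj fun h' => g h' U]
    refine Finset.sum_le_sum fun h _ => ?_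
    by_cases hm : m₀ h U = 0
    · rw [hm, zero_mul]; exact Finset.sum_nonneg fun h' _ => hg0 h' U
    · obtain ⟨h₁, hh₁, hone⟩ := hcover h U hm
      have hpos : 0 ≤ m₀' h U * Real.exp (F₀ h U) := mul_nonneg (hm₀'0 h U) (Real.exp_pos _).le
      have hmem : h₁ ∈ Finset.univ.filter (fun h' => proj h' = h) := Finset.mem_filter.mpr ⟨Finset.mem_univ _, hh₁⟩
      calc m₀ h U * Real.exp (F₀ h U)
          ≤ m₀' h U * Real.exp (F₀ h U) := mul_le_mul_of_nonneg_right (hle h U) (Real.exp_pos _).le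
        _ = 1 * (m₀' h U * Real.exp (F₀ h U)) := (one_mul _).symm
        _ ≤ (w h₁ U * χB h₁ U) * (m₀' h U * Real.exp (F₀ h U)) := mul_le_mul_of_nonneg_right hone hpos
        _ = g h₁ U := by rw [hg]; simp only [hh₁]
        _ ≤ ∑ h' ∈ Finset.univ.filter (fun h' => proj h' = h), g h' U :=
            Finset.single_le_sum (f := fun h' => g h' U) (fun h' _ => hg0 h' U) hmem
  -- Step B: `Tρ ≤ T(Σ g)` a.e., and `T(Σ g) = Σ T g` a.e.
  have hA : rnTransport avg ρ ≤ᵐ[fieldMeasure P (j + 1) G] rnTransport avg (fun U => ∑ h', g h' U) :=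
    rnTransport_mono_ae hac hpt hρ (integrable_finsetSum _ fun h' _ => hgi h')
  have hBsum : rnTransport avg (fun U => ∑ h', g h' U) =ᵐ[fieldMeasure P (j + 1) G]
      fun V => ∑ h', rnTransport avg (g h') V :=
    rnTransport_sum_ae hac Finset.univ g fun h' _ => hgi h'
  -- gather the finitely many a.e. statements
  have hE' := ae_all_iff.mpr hfibre
  have hF' := ae_all_iff.mpr hm₁
  filter_upwards [hA, hBsum, hE', hF'] with V hA hBsum hE hF
  calc rnTransport avg ρ V ≤ rnTransport avg (fun U => ∑ h', g h' U) V := hA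
    _ = ∑ h', rnTransport avg (g h') V := hBsum
    _ ≤ ∑ h', m₁ h' V * B h' V := by
        refine Finset.sum_le_sum fun h' _ => ?_
        calc rnTransport avg (g h') V ≤ rnTransport avg (fun U => w h' U * m₀' (proj h') U) V * B h' V := hE h'
          _ ≤ m₁ h' V * B h' V := mul_le_mul_of_nonneg_right (hF h') (hB h' V)

/-- ★ **THE SAME FROM AN A.E. MAJORISATION** — the cell's densities are Radon–Nikodym VERSIONS (★★OWNER RULING №32), so the pinned tower is only
known to lie below `Σ_h m₀(h)e^{F₀(h)}` `dU`-a.e.; `T` is monotone under a.e. comparison of non-negative integrable densities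
(`TransportAC.rnTransport_mono_ae_of_ae_le`), so §1 applies to the majorant itself. [cite: Balaban1985UV3, (48)-(49) pp.267-268] -/
theorem transport41_le_sum_ae_of_ac_of_ae_le (hac : AvgAC avg)
    (proj : H₁ → H₀) (ρ : Density P j G) (hρ : Integrable ρ (fieldMeasure P j G)) (hρ0 : ∀ U, 0 ≤ ρ U)
    (m₀ m₀' : H₀ → Density P j G) (F₀ : H₀ → GaugeField P j G → ℝ)
    (w χB : H₁ → Density P j G) (m₁ B : H₁ → Density P (j + 1) G)
    (h41 : ρ ≤ᵐ[fieldMeasure P j G] fun U => ∑ h, m₀ h U * Real.exp (F₀ h U))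
    (hint : ∀ h, Integrable (fun U => m₀ h U * Real.exp (F₀ h U)) (fieldMeasure P j G))
    (hm₀0 : ∀ h U, 0 ≤ m₀ h U) (hle : ∀ h U, m₀ h U ≤ m₀' h U)
    (hint' : ∀ h, Integrable (fun U => m₀' h U * Real.exp (F₀ h U)) (fieldMeasure P j G))
    (hw : ∀ h', Measurable (w h')) (hw0 : ∀ h' U, 0 ≤ w h' U) (hw1 : ∀ h' U, w h' U ≤ 1)
    (hχ : ∀ h', Measurable (χB h')) (hχ0 : ∀ h' U, 0 ≤ χB h' U) (hχ1 : ∀ h' U, χB h' U ≤ 1)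
    (hcover : ∀ h U, m₀ h U ≠ 0 → ∃ h', proj h' = h ∧ (1 : ℝ) ≤ w h' U * χB h' U)
    (hm₁ : ∀ h', (rnTransport avg fun U => w h' U * m₀' (proj h') U) ≤ᵐ[fieldMeasure P (j + 1) G] m₁ h')
    (hB : ∀ h' V, 0 ≤ B h' V)
    (hfibre : ∀ h', (rnTransport avg (fun U => w h' U * χB h' U * (m₀' (proj h') U * Real.exp (F₀ (proj h') U))))
      ≤ᵐ[fieldMeasure P (j + 1) G] fun V => rnTransport avg (fun U => w h' U * m₀' (proj h') U) V * B h' V) :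
    rnTransport avg ρ ≤ᵐ[fieldMeasure P (j + 1) G] fun V => ∑ h', m₁ h' V * B h' V := by
  set R : Density P j G := fun U => ∑ h, m₀ h U * Real.exp (F₀ h U) with hR
  have hR0 : ∀ U, 0 ≤ R U := fun U => Finset.sum_nonneg fun h _ => mul_nonneg (hm₀0 h U) (Real.exp_pos _).le
  have hRi : Integrable R (fieldMeasure P j G) := integrable_finsetSum _ fun h _ => hint h
  have hA : rnTransport avg ρ ≤ᵐ[fieldMeasure P (j + 1) G] rnTransport avg R :=
    rnTransport_mono_ae_of_ae_le hac hρ0 hR0 h41 hρ hRi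
  have hmain := transport41_le_sum_ae_of_ac_of_le hac proj R hRi m₀ m₀' F₀ w χB m₁ B (fun U => le_rfl) hm₀0 hle hint'
    hw hw0 hw1 hχ hχ0 hχ1 hcover hm₁ hB hfibre
  filter_upwards [hA, hmain] with V hA hmain
  exact hA.trans hmain

end Transport

/-! ## §2 The pinned cover -/

section Cover

variable {P : Params} {G : Type} [GaugeGroup G] (M₁ : ℕ) (Rcol : ℕ → ℕ) (εL : ℕ → ℝ)

open Classical in
/-- ★ **A PLAQUETTE LARGE AT A THRESHOLD `θ ≥ εL k` INSIDE THE DECOMPOSITION DOMAIN `Ω_k(h)` LIES IN «THE» LARGE-FIELD SET OF THE CONFIGURATION**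
(`Bound55Masses.largeSet` = print's `P` of (7)–(8) at scale `k`). [cite: Balaban1985UV3, (7)-(8) pp.257-258] -/
theorem mem_largeSet_of_le (k : ℕ) (h : Hist P k) (U : GaugeField P k G) (a : Plaq P k) {θ : ℝ}
    (hθ : εL k ≤ θ) (hcov : plaqCover a ⊆ Omega M₁ Rcol k h k) (ha : θ ≤ dist1 (GaugeField.plaqHol U a)) :
    a ∈ largeSet M₁ Rcol εL k h U := by
  rw [largeSet, Finset.mem_filter]
  exact ⟨Finset.mem_univ _, hcov, hθ.trans ha⟩

open Classical in
/-- ★ **THE PINNED COVER**: under the same hypotheses the lane's covering new history `h ⌢ largeSet(h,U)` of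
`Bound55Masses.stepWeight_mul_chiB_cover` carries `a` in its newborn large-field set `last` — the event «`a` large» is the pin «`a ∈ P_k`» of the
step-`k` decomposition of unity, literally (px8 g10 memo v1.1; px13 g11 LOCATE §3). [cite: Balaban1985UV3, (7)-(8) pp.257-258 + (48) p.267] -/
theorem mem_last_snoc_largeSet_of_le (k : ℕ) (h : Hist P k) (U : GaugeField P k G) (a : Plaq P k) {θ : ℝ}
    (hθ : εL k ≤ θ) (hcov : plaqCover a ⊆ Omega M₁ Rcol k h k) (ha : θ ≤ dist1 (GaugeField.plaqHol U a)) :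
    a ∈ (Hist.snoc h (largeSet M₁ Rcol εL k h U)).last := by
  rw [Hist.last_snoc]
  exact mem_largeSet_of_le M₁ Rcol εL k h U a hθ hcov ha

end Cover

/-! ## §3 The restricted history sum against the penalised functional of (41) -/

section Restricted

variable {P : Params} {G : Type} (W : HistWeightsAC P G)

open Classical in
/-- ★ **A RESTRICTED HISTORY SUM IS BELOW THE PENALISED FUNCTIONAL**: for a sub-family `S` of histories and ANY penalty `π` vanishing on `S`
(no sign needed off `S`: those terms are non-negative whatever the exponent), `Σ_{h ∈ S} m_k(h,U)·e^{F h} ≤ LFAC W k U (F − π)` — the pinned (41) in the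
currency of ✓`UV3PinnedLargeFieldResummation.largeField_pinned_of_resummation` (`LF k U (F − π)`, `π ≥ M` off the pin). [cite: Balaban1985UV3, (41) p.266] -/
theorem sum_filter_mul_exp_le_lfAC_sub (k : ℕ) (U : GaugeField P k G) (F π : Hist P k → ℝ) (S : Finset (Hist P k))
    (hπS : ∀ h ∈ S, π h = 0) :
    ∑ h ∈ S, W.mass k h U * Real.exp (F h) ≤ LFAC W k U (fun h => F h - π h) := by
  unfold LFAC
  have hterm : ∀ h, 0 ≤ W.mass k h U * Real.exp (F h - π h) := fun h =>
    mul_nonneg (W.mass_nonneg k h U) (Real.exp_pos _).le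
  calc ∑ h ∈ S, W.mass k h U * Real.exp (F h)
      = ∑ h ∈ S, W.mass k h U * Real.exp (F h - π h) :=
        Finset.sum_congr rfl fun h hh => by rw [hπS h hh, sub_zero]
    _ ≤ ∑ h, W.mass k h U * Real.exp (F h - π h) :=
        Finset.sum_le_univ_sum_of_nonneg fun h => hterm h

end Restricted

end Summit.QuantumFields.YangMills.Theorems.UV3PinnedTransportStep

end
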